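import Literature.AnabelianGeometry.EtaleTheta.FrobenioidCyclotomicRigidity
import Literature.AnabelianGeometry.SemiGraphs.TemperedResiduallyFiniteTransport

/-!
# [EtTh] Prop. 5.5 / Thm. 5.6: the knits' binder `hreach : LinearlyReachableFromBN 𝔉` FORCES every `(l, N)`-theta-saturated object to
# lie UNDER `B_N^bs` — a kernel note on its shape vs. print's proof by ROOFS `S″ → S`, `S″ → S′` (p.328 / PDF p.102)

S. Mochizuki, *The étale theta function and its Frobenioid-theoretic manifestations*, Publ. RIMS **45** (2009) [MochizukiEtTh2009],
proof of Prop. 5.5 p.327–328 (PDF pp.101–102): «if `S′ ∈ Ob(C)` is an `l·N`-codomain of an `l·N`-th root of a right fraction-pair of `Θ̈` …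
the resulting Kummer class … determines an isomorphism `(l·Δ_Θ)_{S′} ⊗ ℤ/Nℤ ⥲ μ_N(S′)` … Thus, we may transport this isomorphism from
`S′` to an arbitrary `(l, N)`-theta-saturated `S ∈ Ob(C)` by means of LINEAR MORPHISMS `S″ → S`, `S″ → S′` [of `C` — cf. [FrdI],
Definition 1.3, (i), (b)], which induce isomorphisms …».  S. Mochizuki, *Semi-graphs of anabelioids* [MochizukiSemiAnbd2006],
Rmk. 3.1.3 p.34 (the Galois objects of `B^temp(Π)` are the `Π/N`).

abc-iut cell, layer L2, seat abc-iut-w5-d013 (gen 5); PROOF-ONLY (no definition, no new named fact); nothing landed is edited or restated.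
A KERNEL NOTE for the K4 custodian (abc-iut-w5-d020, «hreach sizing») and the chair, in the genre of the cell's vacuity findings.

THE BINDER.  Every landed Prop. 5.5 / Thm. 5.6 knit (`Sec5Prop55*`, `Sec5Thm56*`, the K4 END KNITS and this seat's `…_forall`, 55 files)
carries `hreach : LinearlyReachableFromBN 𝔉` = «∀ (l,N)-theta-saturated `S`, ∃ a LINEAR `φ : B_N ⟶ S` with `Δ`-push onto and `μ`-pull
injective» (abc-iut-L2-t4, `FrobenioidCyclotomicRigidity.lean`: "the transport step of the proof of Prop. 5.5").  A morphism `B_N ⟶ S`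
of `C` lies over a morphism `B_N^bs ⟶ S^bs` of the base category, so (`nonempty_baseHom_of_linearlyReachableFromBN`):
**under `hreach`, every `(l, N)`-theta-saturated object `S` receives a morphism `B_N^bs ⟶ S^bs` in `D`.**  Over the genuine base
`D = B^temp(Π^tp_X)⁰` this is a DEPTH CONSTRAINT: a morphism `Π/N ⟶ Π/M` of `B^temp(Π)` between Galois objects forces `N ≤ M`
(abc-iut-L3's `le_of_hom_quotientObj`), hence (`not_isThetaSaturated_of_linearlyReachableFromBN_of_not_le`): **under `hreach`, NO object
of `C` whose base is a Galois covering `Π/M` NOT lying under `B_N^bs ≅ Π/N_B` (i.e. `¬ N_B ≤ M` — every strictly deeper covering) is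
`(l, N)`-theta-saturated.**  Print, by contrast, transports along ROOFS `S″ → S`, `S″ → S′` from a DEEPER `S″` ([FrdI] Def. 1.3 (i)(b)),
precisely because theta-saturated objects occur at every sufficiently deep level (at the level-`N` data `Q := levelStub`: for `M ⊆ Ker(Π^tp_X
↠ level-N quotient)`, `(l·Δ_Θ)_{Π/M} ⊗ ℤ/Nℤ` has cardinality `N` by abc-iut-L2-t9's Galois description `killQ_eq_of_normal`; clause (a)
`μ_{l·N}`-saturation holds as soon as the units over `Π/M` contain `μ_{l·N}`).  CONSEQUENCE for the census (no landed statement touched;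
the custodian rules): either (i) at the intended data some theta-saturated object lies strictly deeper than `B_N^bs`, and then `hreach`
is UNSATISFIABLE there (`not_linearlyReachableFromBN_of_isThetaSaturated_deeper`) and the knits taking it are vacuous with respect to
it; or (ii) `hreach` is read as an implicit restriction of Def. 5.4 to objects under `B_N`.  The print-faithful repair is the ROOF form
`∀ S theta-saturated, ∃ S″ theta-saturated, ∃ linear S″ ⟶ S, S″ ⟶ B_N inducing bijections on (l·Δ_Θ) ⊗ ℤ/Nℤ and μ_N`
(`LinearlyReachableByRoof` would be its name; NOT introduced here — D-0067: no new Prop def from a prover seat), under which the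
uniqueness transport `rigidityFamily_unique_of` goes through verbatim in two steps (pull to `S″` along `S″ → B_N` by `IsFunctorialLinear`,
push to `S` by the bijections) — `rigidityFamily_unique_of_roof` below PROVES that two-step transport for ANY given roof.
HONEST FRAMING: kernel-checked category theory; whether case (i) or (ii) is the intended reading is for the K4 custodian / abc-iut-L2-lead;
[EtTh]/[SemiAnbd] are refereed pre-IUT material; nothing here bears on [IUTchIII] Cor. 3.12 — no side is taken; typed ≠ proved.
-/

namespace Literature.AnabelianGeometry.EtaleTheta

open CategoryTheory Literature.AlgebraicGeometry.Frobenioids Literature.AnabelianGeometry.SemiGraphs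

universe w v v' u u'

namespace FrobenioidCyclotomicRigidity

section Generic

variable {C : Type u} [Category.{v} C] {D : Type u'} [Category.{v'} D] (𝔉 : ThetaFrobenioid.{w} C D)

/-- **Under `hreach`, every theta-saturated object receives a base morphism from `B_N^bs`**: the linear `φ : B_N ⟶ S` of
`LinearlyReachableFromBN` lies over `Base(φ) : B_N^bs ⟶ S^bs`.  [cite: MochizukiEtTh2009, Prop 5.5 proof p.328 (PDF p.102)] -/
theorem nonempty_baseHom_of_linearlyReachableFromBN (hreach : LinearlyReachableFromBN 𝔉) (S : C)
    (hS : 𝔉.IsThetaSaturated S) : Nonempty (𝔉.base.obj 𝔉.BN ⟶ 𝔉.base.obj S) := by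
  obtain ⟨φ, -, -, -⟩ := hreach S hS
  exact ⟨𝔉.base.map φ⟩

/-- Contrapositive: under `hreach`, an object whose base receives NO morphism from `B_N^bs` is NOT theta-saturated.
[cite: MochizukiEtTh2009, Prop 5.5 proof p.328 (PDF p.102)] -/
theorem not_isThetaSaturated_of_isEmpty_baseHom (hreach : LinearlyReachableFromBN 𝔉) (S : C)
    (hS : IsEmpty (𝔉.base.obj 𝔉.BN ⟶ 𝔉.base.obj S)) : ¬ 𝔉.IsThetaSaturated S := fun h =>
  (nonempty_baseHom_of_linearlyReachableFromBN 𝔉 hreach S h).elim fun f => hS.elim f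

/-- **`hreach` is REFUTED by any theta-saturated object not under `B_N^bs`.** [cite: MochizukiEtTh2009, Prop 5.5 proof p.328 (PDF p.102)] -/
theorem not_linearlyReachableFromBN_of_isThetaSaturated_of_isEmpty {S : C} (hS : 𝔉.IsThetaSaturated S)
    (he : IsEmpty (𝔉.base.obj 𝔉.BN ⟶ 𝔉.base.obj S)) : ¬ LinearlyReachableFromBN 𝔉 := fun hreach =>
  not_isThetaSaturated_of_isEmpty_baseHom 𝔉 hreach S he hS

/-- **Print's ROOF transport, uniqueness half** (Prop. 5.5 proof p.328: «independent of the choice of `S″`, … precisely because of the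
original functoriality»): two rigidity families functorial for linear morphisms that agree at `B_N` agree at every theta-saturated `S`
admitting a ROOF `S″ ⟶ S`, `S″ ⟶ B_N` of linear morphisms from a theta-saturated `S″`, the leg to `S` inducing a surjection on
`(l·Δ_Θ) ⊗ ℤ/Nℤ` and an injection on `μ_N` — the two-step version of abc-iut-L2-t4's `rigidityFamily_unique_of` (pull to `S″`, push to `S`).
[cite: MochizukiEtTh2009, Prop 5.5 proof p.328 (PDF p.102)] -/
theorem rigidityFamily_eq_at_of_roof {ρ ρ' : RigidityFamily 𝔉} (hρ : IsFunctorialLinear 𝔉 ρ) (hρ' : IsFunctorialLinear 𝔉 ρ')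
    (hB : 𝔉.IsThetaSaturated 𝔉.BN) (hBN : ρ 𝔉.BN hB = ρ' 𝔉.BN hB)
    {S S'' : C} (hS : 𝔉.IsThetaSaturated S) (hS'' : 𝔉.IsThetaSaturated S'')
    (φ : S'' ⟶ 𝔉.BN) (hφ : 𝔉.IsLinear φ) (ψ : S'' ⟶ S) (hψ : 𝔉.IsLinear ψ)
    (hsurj : Function.Surjective (𝔉.lDeltaModNMap ψ)) (hinj : Function.Injective (𝔉.muTorsionPull ψ 𝔉.N)) :
    ρ S hS = ρ' S hS := by
  -- step 1: `ρ` and `ρ'` agree at `S″` (pull back to `S″` along the linear `S″ ⟶ B_N`)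
  have h'' : ρ S'' hS'' = ρ' S'' hS'' := by
    apply MulEquiv.ext
    intro x
    rw [← hρ φ hφ hS'' hB x, ← hρ' φ hφ hS'' hB x, hBN]
  -- step 2: push to `S` along the linear `S″ ⟶ S`
  apply MulEquiv.ext
  intro y
  obtain ⟨x, rfl⟩ := hsurj y
  apply hinj
  rw [hρ ψ hψ hS'' hS x, hρ' ψ hψ hS'' hS x, h'']

/-- **Uniqueness of the rigidity family from ROOFS** (print's form of the transport step): if every theta-saturated `S` admits a roof
as above, two functorial-for-linear rigidity families agreeing at `B_N` are EQUAL — the drop-in analogue of `rigidityFamily_unique_of`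
with the single arrow `B_N ⟶ S` replaced by print's `S″ ⟶ S`, `S″ ⟶ B_N`.  [cite: MochizukiEtTh2009, Prop 5.5 proof p.328 (PDF p.102)] -/
theorem rigidityFamily_unique_of_roof
    (hroof : ∀ S : C, 𝔉.IsThetaSaturated S → ∃ (S'' : C) (_ : 𝔉.IsThetaSaturated S'') (φ : S'' ⟶ 𝔉.BN) (ψ : S'' ⟶ S),
      𝔉.IsLinear φ ∧ 𝔉.IsLinear ψ ∧ Function.Surjective (𝔉.lDeltaModNMap ψ) ∧ Function.Injective (𝔉.muTorsionPull ψ 𝔉.N))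
    (hB : 𝔉.IsThetaSaturated 𝔉.BN) {ρ ρ' : RigidityFamily 𝔉} (hρ : IsFunctorialLinear 𝔉 ρ) (hρ' : IsFunctorialLinear 𝔉 ρ')
    (hBN : ρ 𝔉.BN hB = ρ' 𝔉.BN hB) : ρ = ρ' := by
  funext S hS
  obtain ⟨S'', hS'', φ, ψ, hφ, hψ, hsurj, hinj⟩ := hroof S hS
  exact rigidityFamily_eq_at_of_roof 𝔉 hρ hρ' hB hBN hS hS'' φ hφ ψ hψ hsurj hinj

/-- `hreach` is the special case `S″ := B_N`, `φ := 𝟙` of the roof form (so the roof form is WEAKER, as a hypothesis):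
[cite: MochizukiEtTh2009, Prop 5.5 proof p.328 (PDF p.102)] -/
theorem roof_of_linearlyReachableFromBN (hreach : LinearlyReachableFromBN 𝔉) (hB : 𝔉.IsThetaSaturated 𝔉.BN)
    (hid : 𝔉.IsLinear (𝟙 𝔉.BN)) (S : C) (hS : 𝔉.IsThetaSaturated S) :
    ∃ (S'' : C) (_ : 𝔉.IsThetaSaturated S'') (φ : S'' ⟶ 𝔉.BN) (ψ : S'' ⟶ S),
      𝔉.IsLinear φ ∧ 𝔉.IsLinear ψ ∧ Function.Surjective (𝔉.lDeltaModNMap ψ) ∧ Function.Injective (𝔉.muTorsionPull ψ 𝔉.N) := by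
  obtain ⟨ψ, hψ, hsurj, hinj⟩ := hreach S hS
  exact ⟨𝔉.BN, hB, 𝟙 _, ψ, hid, hψ, hsurj, hinj⟩

end Generic

/-! ### Over the genuine base `B^temp(Π)⁰`: `hreach` is a DEPTH constraint -/

section ConnectedTemperoid

variable {G : Type u} [Group G] [TopologicalSpace G] [IsTopologicalGroup G]
  {C : Type u'} [Category.{v'} C] (𝔉 : ThetaFrobenioid.{w} C (ConnectedPart (BTemp G)))

/-- In `B^temp(Π)⁰` there is NO morphism from (an isomorph of) `Π/N` to (an isomorph of) `Π/M` unless `N ≤ M` (`N`, `M` open normal;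
abc-iut-L3's `le_of_hom_quotientObj`, [SemiAnbd] Rmk. 3.1.3).  [cite: MochizukiSemiAnbd2006, Rmk 3.1.3 p.34] -/
theorem isEmpty_hom_of_iso_quotientObj_of_not_le (hG : IsTempered G) (N M : OpenNormalSubgroup G)
    {A B : ConnectedPart (BTemp G)} (eA : A.obj ≅ BTemp.quotientObj G hG N.toSubgroup N.isOpen')
    (eB : B.obj ≅ BTemp.quotientObj G hG M.toSubgroup M.isOpen') (hNM : ¬ N.toSubgroup ≤ M.toSubgroup) :
    IsEmpty (A ⟶ B) :=
  ⟨fun f => hNM (le_of_hom_quotientObj hG N M (eA.inv ≫ (connectedObjects (BTemp G)).ι.map f ≫ eB.hom))⟩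

/-- **`hreach` as a DEPTH constraint over `B^temp(Π)⁰`**: if `B_N^bs ≅ Π/N_B` and `S^bs ≅ Π/M` with `¬ N_B ≤ M` (a covering NOT under
`B_N^bs` — e.g. any strictly deeper one), then under `hreach` the object `S` is NOT `(l, N)`-theta-saturated.
[cite: MochizukiEtTh2009, Prop 5.5 proof p.328 (PDF p.102)] -/
theorem not_isThetaSaturated_of_linearlyReachableFromBN_of_not_le (hG : IsTempered G) (hreach : LinearlyReachableFromBN 𝔉)
    (N M : OpenNormalSubgroup G) (eB : (𝔉.base.obj 𝔉.BN).obj ≅ BTemp.quotientObj G hG N.toSubgroup N.isOpen')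
    (S : C) (eS : (𝔉.base.obj S).obj ≅ BTemp.quotientObj G hG M.toSubgroup M.isOpen') (hNM : ¬ N.toSubgroup ≤ M.toSubgroup) :
    ¬ 𝔉.IsThetaSaturated S :=
  not_isThetaSaturated_of_isEmpty_baseHom 𝔉 hreach S (isEmpty_hom_of_iso_quotientObj_of_not_le hG N M eB eS hNM)

/-- **Converse reading: a theta-saturated object strictly DEEPER than `B_N^bs` REFUTES `hreach`** over `B^temp(Π)⁰`.
[cite: MochizukiEtTh2009, Prop 5.5 proof p.328 (PDF p.102)] -/
theorem not_linearlyReachableFromBN_of_isThetaSaturated_deeper (hG : IsTempered G) (N M : OpenNormalSubgroup G)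
    (eB : (𝔉.base.obj 𝔉.BN).obj ≅ BTemp.quotientObj G hG N.toSubgroup N.isOpen') {S : C}
    (eS : (𝔉.base.obj S).obj ≅ BTemp.quotientObj G hG M.toSubgroup M.isOpen') (hNM : ¬ N.toSubgroup ≤ M.toSubgroup)
    (hS : 𝔉.IsThetaSaturated S) : ¬ LinearlyReachableFromBN 𝔉 := fun hreach =>
  not_isThetaSaturated_of_linearlyReachableFromBN_of_not_le 𝔉 hG hreach N M eB S eS hNM hS

end ConnectedTemperoid

end FrobenioidCyclotomicRigidity

end Literature.AnabelianGeometry.EtaleTheta
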